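import Summits.MatrixMultiplication.OmegaCensus.MetacyclicPCubeSmall

/-!
# ω-census, family (b3): conjecture C9 — the whole metacyclic tower `M_p(m,1) = ℤ/p^m ⋊ ℤ/p` (`m ≥ 2`, odd `p`) is not box-useful

HONEST FRAMING (pub-omega census; verbatim): lottery ticket; floor = certified bounds/negative ranges.
Census BOOKKEEPING (conjecture C9 of the cell; pub-omega stpp-1 gen 19).  Rédei's metacyclic minimal non-abelian `p`-groups
`M_p(m,n)` map onto `M_p(m,1) = ⟨a,b | a^{p^m} = b^p = 1, b a b⁻¹ = a^{1+p^{m−1}}⟩` (order `p^{m+1}`, centre `⟨a^p⟩` of index `p²`,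
commutator group `⟨a^{p^{m−1}}⟩` of order `p`; every proper section abelian).  Kernel model `Mmeta p m`: `(t, x) ∈ ℤ/p × ℤ/p^m`,
`(t,x)(t',x') = (t+t', x + x' + p^{m−1}·t̂·x')` (axioms PROVED for `m ≥ 2`).  THE POINT: with `q = p^{m−1}` in place of `p` in the
cocycle, the height analysis of `MetacyclicPCube` goes through VERBATIM — classes `(t₀, K₁) ∈ ℤ/p × ℤ/q`, heights `h ∈ ℤ/p` along the
commutator group, and the SAME forbidden differences `IBox.tauI` (mod `p`): `dvd_of_cellWord'`, `dvd_height_of_cellWord'` (exact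
identity mod `p^m`, the same machine-derived remainder with `p ↦ q`).  Hence `IBox.not_boxUseful_mmeta_of_pattern`: any independent
height pattern with `9p ≤ 5·#T` — in particular the ones ALREADY LANDED for `M(p³)` (`TMunif p` for odd `p ≥ 41`, `TM3 … TM39`) —
makes `Mmeta p m` not box-useful (assembly for all odd `p` in the sequel file).  With `Heis.not_boxUseful_heis_odd`, `RedeiN` and
Rédei's classification this is the last family needed for: C9 (b) holds for every finite `p`-group, `p` odd (desk consequence; the
classification itself is not typed).  Nothing here is progress on `ω`.
-/

namespace Summit.MatrixMultiplication.OmegaCensus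

open Finset ProductBoxBound

/-- `M_p(m,1)`: pairs `(t, x) ∈ ℤ/p × ℤ/p^m`, `b^t a^x` with `b a b⁻¹ = a^{1+p^{m-1}}`. [folklore] -/
structure Mmeta (p m : ℕ) where
  /-- exponent of `b` -/
  t : ZMod p
  /-- exponent of `a` -/
  x : ZMod (p ^ m)
  deriving DecidableEq

namespace Mmeta

variable {p m : ℕ}

/-- Two elements agree iff both coordinates agree. [folklore] -/
@[ext] theorem ext {g h : Mmeta p m} (ht : g.t = h.t) (hx : g.x = h.x) : g = h := by
  cases g; cases h; congr

/-- The section `ℤ/p → ℤ/p^m`, `t ↦ t.val`. [folklore] -/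
def L (m : ℕ) (t : ZMod p) : ZMod (p ^ m) := ((t.val : ℕ) : ZMod (p ^ m))

/-- `q = p^{m−1}` in `ℤ/p^m`. [folklore] -/
def Q (p m : ℕ) : ZMod (p ^ m) := ((p ^ (m - 1) : ℕ) : ZMod (p ^ m))

/-- Product `(t,x)(t',x') = (t+t', x + x' + q·t̂·x')`. [folklore] -/
instance : Mul (Mmeta p m) := ⟨fun g h => ⟨g.t + h.t, g.x + h.x + Q p m * L m g.t * h.x⟩⟩
/-- Identity. [folklore] -/
instance : One (Mmeta p m) := ⟨⟨0, 0⟩⟩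
/-- Inverse `(t,x)⁻¹ = (−t, −x + q t̂ x)`. [folklore] -/
instance : Inv (Mmeta p m) := ⟨fun g => ⟨-g.t, -g.x + Q p m * L m g.t * g.x⟩⟩

/-- The multiplication rule, unfolded. [folklore] -/
theorem mul_def (g h : Mmeta p m) : g * h = ⟨g.t + h.t, g.x + h.x + Q p m * L m g.t * h.x⟩ := rfl
/-- The identity, unfolded. [folklore] -/
theorem one_def : (1 : Mmeta p m) = ⟨0, 0⟩ := rfl
/-- The inverse, unfolded. [folklore] -/
theorem inv_def (g : Mmeta p m) : g⁻¹ = ⟨-g.t, -g.x + Q p m * L m g.t * g.x⟩ := rfl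

/-- `q·q = 0` in `ℤ/p^m` (`m ≥ 2`). [folklore] -/
theorem QQ_eq_zero [Fact (2 ≤ m)] : Q p m * Q p m = 0 := by
  have hm : 2 ≤ m := Fact.out
  rw [Q, ← Nat.cast_mul, ← pow_add, show m - 1 + (m - 1) = m + (m - 2) by omega, pow_add, Nat.cast_mul, ZMod.natCast_self,
    zero_mul]

/-- `q·p = 0` in `ℤ/p^m`. [folklore] -/
theorem Q_mul_p [Fact (2 ≤ m)] : Q p m * (p : ZMod (p ^ m)) = 0 := by
  have hm : 2 ≤ m := Fact.out
  rw [Q, ← Nat.cast_mul, ← pow_succ, show m - 1 + 1 = m by omega, ZMod.natCast_self]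

/-- **Core congruence**: `q · (T mod p)^ = q · T` in `ℤ/p^m`. [folklore] -/
theorem Q_mul_L_intCast [NeZero p] [Fact (2 ≤ m)] (T : ℤ) :
    Q p m * L m ((T : ZMod p)) = Q p m * (T : ZMod (p ^ m)) := by
  have hv : (((T : ZMod p).val : ℕ) : ZMod (p ^ m)) = ((((T : ZMod p).val : ℕ) : ℤ) : ZMod (p ^ m)) := by push_cast; rfl
  rw [L, hv, ZMod.val_intCast, Int.emod_def]
  push_cast
  linear_combination (-((T / (p : ℤ) : ℤ) : ZMod (p ^ m))) * (Q_mul_p (p := p) (m := m))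

/-- `q · n^ = q · n` for naturals. [folklore] -/
theorem Q_mul_L_natCast [NeZero p] [Fact (2 ≤ m)] (n : ℕ) :
    Q p m * L m ((n : ZMod p)) = Q p m * (n : ZMod (p ^ m)) := by
  have := Q_mul_L_intCast (p := p) (m := m) (n : ℤ)
  push_cast at this
  exact this

/-- `t ↦ q·t̂` is additive. [folklore] -/
theorem Q_mul_L_add [NeZero p] [Fact (2 ≤ m)] (a b : ZMod p) :
    Q p m * L m (a + b) = Q p m * L m a + Q p m * L m b := by
  conv_lhs => rw [← ZMod.natCast_zmod_val a, ← ZMod.natCast_zmod_val b, ← Nat.cast_add, Q_mul_L_natCast]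
  conv_rhs => rw [← ZMod.natCast_zmod_val a, ← ZMod.natCast_zmod_val b, Q_mul_L_natCast, Q_mul_L_natCast]
  push_cast; ring

/-- `q·0^ = 0`. [folklore] -/
theorem Q_mul_L_zero : Q p m * L m (0 : ZMod p) = 0 := by
  simp [L, ZMod.val_zero]

/-- `t ↦ q·t̂` is odd. [folklore] -/
theorem Q_mul_L_neg [NeZero p] [Fact (2 ≤ m)] (a : ZMod p) : Q p m * L m (-a) = -(Q p m * L m a) := by
  have h := Q_mul_L_add (p := p) (m := m) a (-a)
  rw [add_neg_cancel, Q_mul_L_zero] at h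
  linear_combination -h

/-- `Mmeta p m` is a group (`m ≥ 2`). [folklore] -/
instance [NeZero p] [Fact (2 ≤ m)] : Group (Mmeta p m) :=
  Group.ofLeftAxioms
    (fun g h k => ext (by simp only [mul_def]; ring) (by
      simp only [mul_def]
      linear_combination k.x * Q_mul_L_add (p := p) (m := m) g.t h.t - (L m g.t * L m h.t * k.x) * QQ_eq_zero (p := p) (m := m)))
    (fun g => ext (by simp only [mul_def, one_def, zero_add]) (by
      simp only [mul_def, one_def, Q_mul_L_zero, zero_mul, add_zero, zero_add]))
    (fun g => ext (by simp only [mul_def, inv_def, one_def, neg_add_cancel]) (by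
      simp only [mul_def, inv_def, one_def]
      linear_combination g.x * Q_mul_L_neg (p := p) (m := m) g.t))

/-- `Mmeta p m ≃ ℤ/p × ℤ/p^m` as types. [folklore] -/
def equivProd : Mmeta p m ≃ ZMod p × ZMod (p ^ m) :=
  ⟨fun g => (g.t, g.x), fun q => ⟨q.1, q.2⟩, fun _ => rfl, fun _ => rfl⟩

/-- Finite, through `equivProd`. [folklore] -/
instance [NeZero p] : Fintype (Mmeta p m) := Fintype.ofEquiv _ equivProd.symm

/-- `|Mmeta p m| = p · p^m`. [folklore] -/
theorem card [NeZero p] : Fintype.card (Mmeta p m) = p * p ^ m := by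
  rw [Fintype.ofEquiv_card, Fintype.card_prod, ZMod.card, ZMod.card]

/-! ### Integer-parametrised elements -/

/-- The element `(T mod p, X)`. [folklore] -/
def mk' (m : ℕ) (T : ℤ) (X : ZMod (p ^ m)) : Mmeta p m := ⟨(T : ZMod p), X⟩

/-- Product of integer-parametrised elements. [folklore] -/
theorem mk'_mul [NeZero p] [Fact (2 ≤ m)] (T T' : ℤ) (X X' : ZMod (p ^ m)) :
    mk' (p := p) m T X * mk' m T' X' = mk' m (T + T') (X + X' + Q p m * (T : ZMod (p ^ m)) * X') :=
  ext (by simp only [mk', mul_def]; push_cast; ring) (by simp only [mk', mul_def, Q_mul_L_intCast])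

/-- Inverse of an integer-parametrised element. [folklore] -/
theorem mk'_inv [NeZero p] [Fact (2 ≤ m)] (T : ℤ) (X : ZMod (p ^ m)) :
    (mk' (p := p) m T X)⁻¹ = mk' m (-T) (-X + Q p m * (T : ZMod (p ^ m)) * X) :=
  ext (by simp only [mk', inv_def]; push_cast; ring) (by simp only [mk', inv_def, Q_mul_L_intCast])

/-- An integer-parametrised element is `1` iff both coordinates vanish. [folklore] -/
theorem mk'_eq_one (T : ℤ) (X : ZMod (p ^ m)) : mk' (p := p) m T X = 1 ↔ (T : ZMod p) = 0 ∧ X = 0 := by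
  rw [one_def, Mmeta.ext_iff]; rfl

end Mmeta

namespace Mcube.IBox

variable (B : IBox) {p m : ℕ}

/-- The `Y`-element `y_k` of `Mmeta p m`. [folklore] -/
def yQ (p m : ℕ) (k : Fin 3) : Mmeta p m := Mmeta.mk' m (B.th k) (B.et k : ZMod (p ^ m))
/-- The `W`-element `w_l` of `Mmeta p m`. [folklore] -/
def wQ (p m : ℕ) (l : Fin 3) : Mmeta p m := Mmeta.mk' m (B.ph l) (B.om l : ZMod (p ^ m))

/-- The cell of column `(k,l)` over the class `(t₀, K₁)` at height `h` (cocycle coefficient `q = p^{m−1}`). [folklore] -/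
def cellQ (p m : ℕ) (c : Fin 3 × Fin 3) (K₁ t₀ h : ℤ) : Mmeta p m × Mmeta p m × Mmeta p m :=
  (Mmeta.mk' m (t₀ - B.th c.1 - B.ph c.2)
      ((K₁ - B.et c.1 - B.om c.2 + (p : ℤ) ^ (m - 1) * (h - (B.th c.1 + B.ph c.2) * K₁) : ℤ) : ZMod (p ^ m)),
    B.yQ p m c.1, B.wQ p m c.2)

/-- The remainder polynomial with a general cocycle coefficient `q`. [folklore] -/
def RsubQ (k k' l l' : Fin 3) (K₁ t₀ _h h' q : ℤ) : ℤ :=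
  (B.ph l') ^ 2 * (B.om l') + (B.th k') * (B.ph l') * (B.et k') + (B.th k') ^ 2 * (B.et k') - 2 * (B.ph l) * (B.ph l') * (B.om l') - (B.ph l) * (B.ph l') * (B.et k') - (B.ph l) * (B.th k') * (B.om l') - 2 * (B.ph l) * (B.th k') * (B.et k') + (B.ph l) ^ 2 * (B.om l') - (B.th k) * (B.ph l') * (B.om l') - 2 * (B.th k) * (B.ph l') * (B.et k') - (B.th k) * (B.th k') * (B.om l') - 2 * (B.th k) * (B.th k') * (B.et k') + (B.th k) * (B.ph l) * (B.et k') + (B.th k) ^ 2 * (B.et k') - h' * (B.ph l') - h' * (B.th k') + h' * (B.ph l) + h' * (B.th k) + K₁ * (B.ph l') ^ 2 + 2 * K₁ * (B.th k') * (B.ph l') + K₁ * (B.th k') ^ 2 + t₀ * (B.ph l') * (B.om l') + t₀ * (B.ph l') * (B.et k') + t₀ * (B.th k') * (B.om l') + t₀ * (B.th k') * (B.et k') + t₀ * (B.ph l) * (B.om l') + t₀ * (B.ph l) * (B.et k') + t₀ * (B.th k) * (B.om l') + t₀ * (B.th k) * (B.et k') - t₀ * K₁ * (B.ph l') - t₀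 * K₁ * (B.th k') - t₀ * K₁ * (B.ph l) - t₀ * K₁ * (B.th k) - t₀ ^ 2 * (B.om l') - t₀ ^ 2 * (B.et k') + t₀ ^ 2 * K₁ + q * (B.ph l) * (B.ph l') ^ 2 * (B.om l') - q * (B.ph l) ^ 2 * (B.ph l') * (B.om l') + q * (B.th k) * (B.th k') * (B.ph l') * (B.et k') + q * (B.th k) * (B.th k') ^ 2 * (B.et k') - q * (B.th k) * (B.ph l) * (B.th k') * (B.et k') - q * (B.th k) ^ 2 * (B.th k') * (B.et k') + q * h' * (B.ph l) * (B.ph l') + q * h' * (B.ph l) * (B.th k') + q * h' * (B.th k) * (B.ph l') + q * h' * (B.th k) * (B.th k') - q * K₁ * (B.ph l) * (B.ph l') ^ 2 - 2 * q * K₁ * (B.ph l) * (B.th k') * (B.ph l') - q * K₁ * (B.ph l) * (B.th k') ^ 2 - q * K₁ * (B.th k) * (B.ph l') ^ 2 - 2 * q * K₁ * (B.th k) * (B.th k') * (B.ph l') - q * K₁ * (B.th k) * (B.th k') ^ 2 - q * t₀ * h' * (B.ph l') - q * t₀ * h' * (B.th k') - q * t₀ * h' * (B.ph l) - q * t₀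 * h' * (B.th k) + q * t₀ * K₁ * (B.ph l') ^ 2 + 2 * q * t₀ * K₁ * (B.th k') * (B.ph l') + q * t₀ * K₁ * (B.th k') ^ 2 + q * t₀ * K₁ * (B.ph l) * (B.ph l') + q * t₀ * K₁ * (B.ph l) * (B.th k') + q * t₀ * K₁ * (B.th k) * (B.ph l') + q * t₀ * K₁ * (B.th k) * (B.th k') + q * t₀ ^ 2 * h' - q * t₀ ^ 2 * K₁ * (B.ph l') - q * t₀ ^ 2 * K₁ * (B.th k')

/-- `q = p^{m−1}` as an integer casts to `Q`. [folklore] -/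
theorem cast_qZ : (((p : ℤ) ^ (m - 1) : ℤ) : ZMod (p ^ m)) = Mmeta.Q p m := by
  simp [Mmeta.Q]

/-- From `q·(X + qR) = 0` in `ℤ/p^m` to `p ∣ X` (`m ≥ 2`). [folklore] -/
theorem dvd_of_q_mul_cast_eq_zero (hp : p ≠ 0) (hm : 2 ≤ m) {X R : ℤ}
    (h : ((((p : ℤ) ^ (m - 1)) * (X + (p : ℤ) ^ (m - 1) * R) : ℤ) : ZMod (p ^ m)) = 0) : (p : ℤ) ∣ X := by
  rw [ZMod.intCast_zmod_eq_zero_iff_dvd] at h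
  push_cast at h
  rw [show ((p : ℤ)) ^ m = (p : ℤ) ^ (m - 1) * p by rw [← pow_succ]; congr 1; omega] at h
  have h1 : (p : ℤ) ∣ X + (p : ℤ) ^ (m - 1) * R :=
    Int.dvd_of_mul_dvd_mul_left (pow_ne_zero _ (by exact_mod_cast hp)) h
  have h2 : (p : ℤ) ∣ (p : ℤ) ^ (m - 1) * R :=
    Dvd.dvd.mul_right (dvd_pow_self (p : ℤ) (by omega)) R
  exact (dvd_add_left h2).mp h1

variable {B}

/-- **Class part**: interacting cells have the same class, `p ∣ t₀ − t₀'` and `p^{m−1} ∣ K₁ − K₁'`. [folklore] -/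
theorem dvd_of_cellWord' [NeZero p] [Fact (2 ≤ m)] {c c' : Fin 3 × Fin 3} {K₁ t₀ h K₁' t₀' h' : ℤ}
    (hw : cellWord (B.cellQ p m c K₁ t₀ h) (B.cellQ p m c' K₁' t₀' h') = 1) :
    (p : ℤ) ∣ t₀ - t₀' ∧ (p : ℤ) ^ (m - 1) ∣ K₁ - K₁' := by
  have hm : 2 ≤ m := Fact.out
  simp only [cellWord, cellQ, yQ, wQ, Mmeta.mk'_mul, Mmeta.mk'_inv, Mmeta.mk'_eq_one] at hw
  obtain ⟨ht, hx⟩ := hw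
  refine ⟨?_, ?_⟩
  · have h1 := (ZMod.intCast_zmod_eq_zero_iff_dvd _ _).1 ht
    have e : t₀ - B.th c.1 - B.ph c.2 + -(t₀' - B.th c'.1 - B.ph c'.2) + (B.th c.1 + -B.th c'.1) +
        (B.ph c.2 + -B.ph c'.2) = t₀ - t₀' := by ring
    rwa [e] at h1
  · have hdvd : p ^ (m - 1) ∣ p ^ m := pow_dvd_pow p (by omega)
    have hq0 : (ZMod.castHom hdvd (ZMod (p ^ (m - 1)))) (Mmeta.Q p m) = 0 := by
      rw [Mmeta.Q, map_natCast, ZMod.natCast_self]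
    have hx' := congrArg (ZMod.castHom hdvd (ZMod (p ^ (m - 1)))) hx
    simp only [map_add, map_neg, map_mul, map_intCast, map_zero, hq0, zero_mul, add_zero] at hx'
    have hpq : (p : ZMod (p ^ (m - 1))) ^ (m - 1) = 0 := by rw [← Nat.cast_pow]; exact ZMod.natCast_self _
    push_cast at hx'
    simp only [hpq, zero_mul, add_zero] at hx'
    have h2 : ((K₁ - K₁' : ℤ) : ZMod (p ^ (m - 1))) = 0 := by
      push_cast
      linear_combination hx'
    have := (ZMod.intCast_zmod_eq_zero_iff_dvd _ _).1 h2
    exact_mod_cast this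

/-- **Height part**: interacting cells of the same class have heights differing by `tauI` mod `p`. [folklore] -/
theorem dvd_height_of_cellWord' [NeZero p] [Fact (2 ≤ m)] {c c' : Fin 3 × Fin 3} {K₁ t₀ h h' : ℤ}
    (hw : cellWord (B.cellQ p m c K₁ t₀ h) (B.cellQ p m c' K₁ t₀ h') = 1) : (p : ℤ) ∣ h - h' - B.tauI c c' := by
  have hm : 2 ≤ m := Fact.out
  simp only [cellWord, cellQ, yQ, wQ, Mmeta.mk'_mul, Mmeta.mk'_inv, Mmeta.mk'_eq_one] at hw
  obtain ⟨-, hx⟩ := hw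
  obtain ⟨k, l⟩ := c
  obtain ⟨k', l'⟩ := c'
  refine dvd_of_q_mul_cast_eq_zero (NeZero.ne p) hm (R := RsubQ B k k' l l' K₁ t₀ h h' ((p : ℤ) ^ (m - 1))) ?_
  rw [← cast_qZ] at hx
  simp only [tauI, RsubQ]
  push_cast at hx ⊢
  linear_combination hx

/-- Nondegeneracy for `Mmeta`. [folklore] -/
structure NondegQ (p m : ℕ) : Prop where
  /-- `yQ` injective -/
  y_inj : Function.Injective (B.yQ p m)
  /-- `wQ` injective -/
  w_inj : Function.Injective (B.wQ p m)

/-- The cell set of a pattern: classes `(K₁, t₀) ∈ [0, p^{m−1}) × [0, p)`. [folklore] -/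
def cellSetQ (p m : ℕ) (T : Finset ((Fin 3 × Fin 3) × ZMod p)) : Finset (Mmeta p m × Mmeta p m × Mmeta p m) :=
  T.biUnion fun a => (range (p ^ (m - 1)) ×ˢ range p).image fun q => B.cellQ p m a.1 (q.1 : ℤ) (q.2 : ℤ) (a.2.val : ℤ)

/-- Membership in the cell set. [folklore] -/
theorem mem_cellSetQ {T : Finset ((Fin 3 × Fin 3) × ZMod p)} {P : Mmeta p m × Mmeta p m × Mmeta p m} :
    P ∈ B.cellSetQ p m T ↔
      ∃ a ∈ T, ∃ K₁ t₀ : ℕ, K₁ < p ^ (m - 1) ∧ t₀ < p ∧ P = B.cellQ p m a.1 K₁ t₀ (a.2.val : ℤ) := by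
  constructor
  · intro hP
    obtain ⟨a, ha, hP⟩ := mem_biUnion.1 hP
    obtain ⟨q, hq, hPq⟩ := mem_image.1 hP
    rw [mem_product, mem_range, mem_range] at hq
    exact ⟨a, ha, q.1, q.2, hq.1, hq.2, hPq.symm⟩
  · rintro ⟨a, ha, K₁, t₀, hK, ht, rfl⟩
    exact mem_biUnion.2 ⟨a, ha, mem_image.2 ⟨(K₁, t₀), by rw [mem_product, mem_range, mem_range]; exact ⟨hK, ht⟩, rfl⟩⟩

/-- The cell set lies in the box. [folklore] -/
theorem cellSetQ_subset [NeZero p] (T : Finset ((Fin 3 × Fin 3) × ZMod p)) :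
    B.cellSetQ p m T ⊆ univ ×ˢ ((univ.image (B.yQ p m)) ×ˢ (univ.image (B.wQ p m))) := by
  intro P hP
  obtain ⟨a, -, K₁, t₀, -, -, rfl⟩ := B.mem_cellSetQ.1 hP
  simp only [cellQ, mem_product, mem_univ, true_and, mem_image]
  exact ⟨⟨a.1.1, rfl⟩, ⟨a.1.2, rfl⟩⟩

/-- Integers closer than `N` with `N ∣ a − b` are equal. [folklore] -/
theorem eq_of_dvd_of_lt' {N a b : ℤ} (h : N ∣ a - b) (h1 : a < b + N) (h2 : b < a + N) : a = b := by
  have := Int.eq_zero_of_dvd_of_natAbs_lt_natAbs h (by omega)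
  omega

/-- Cells determine their data. [folklore] -/
theorem cellQ_inj [NeZero p] (hm : 2 ≤ m) (hB : B.NondegQ p m) {c c' : Fin 3 × Fin 3} {K₁ t₀ K₁' t₀' : ℕ}
    {hz hz' : ZMod p} (hK : K₁ < p ^ (m - 1)) (hK' : K₁' < p ^ (m - 1)) (ht : t₀ < p) (ht' : t₀' < p)
    (e : B.cellQ p m c K₁ t₀ (hz.val : ℤ) = B.cellQ p m c' K₁' t₀' (hz'.val : ℤ)) :
    c = c' ∧ K₁ = K₁' ∧ t₀ = t₀' ∧ hz = hz' := by
  simp only [cellQ, Prod.mk.injEq] at e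
  obtain ⟨e1, ey, ew⟩ := e
  have hc : c = c' := Prod.ext (hB.y_inj ey) (hB.w_inj ew)
  subst hc
  rw [Mmeta.mk', Mmeta.mk', Mmeta.ext_iff] at e1
  obtain ⟨et, ex⟩ := e1
  have h1 : (p : ℤ) ∣ (t₀ : ℤ) - t₀' := by
    rw [← ZMod.intCast_zmod_eq_zero_iff_dvd]; push_cast at et ⊢; linear_combination et
  have ht0 : (t₀ : ℤ) = t₀' := eq_of_dvd_of_lt' h1 (by omega) (by omega)
  have hpm : ((p : ℤ)) ^ m = (p : ℤ) ^ (m - 1) * p := by rw [← pow_succ]; congr 1; omega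
  have hKlt : ((K₁ : ℕ) : ℤ) < (p : ℤ) ^ (m - 1) := by exact_mod_cast hK
  have hKlt' : ((K₁' : ℕ) : ℤ) < (p : ℤ) ^ (m - 1) := by exact_mod_cast hK'
  have hD : (p : ℤ) ^ m ∣ ((K₁ : ℤ) - K₁') + (p : ℤ) ^ (m - 1) * ((hz.val : ℤ) - hz'.val - (B.th c.1 + B.ph c.2) * (K₁ - K₁')) := by
    have h0 : ((((K₁ : ℤ) - K₁') + (p : ℤ) ^ (m - 1) * ((hz.val : ℤ) - hz'.val - (B.th c.1 + B.ph c.2) * (K₁ - K₁')) : ℤ) :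
        ZMod (p ^ m)) = 0 := by
      push_cast at ex ⊢; linear_combination ex
    have := (ZMod.intCast_zmod_eq_zero_iff_dvd _ _).1 h0
    exact_mod_cast this
  have hq1 : (p : ℤ) ^ (m - 1) ∣ (K₁ : ℤ) - K₁' :=
    (dvd_add_left (dvd_mul_right _ _)).mp ((pow_dvd_pow (p : ℤ) (by omega : m - 1 ≤ m)).trans hD)
  have hK0 : (K₁ : ℤ) = K₁' := eq_of_dvd_of_lt' hq1 (by omega) (by omega)
  have hK1 : K₁ = K₁' := by exact_mod_cast hK0
  subst hK1
  have h4 : (p : ℤ) ∣ (hz.val : ℤ) - hz'.val := by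
    rw [sub_self, mul_zero, sub_zero, zero_add, hpm] at hD
    exact Int.dvd_of_mul_dvd_mul_left (pow_ne_zero _ (by exact_mod_cast NeZero.ne p)) hD
  have hv := ZMod.val_lt hz
  have hv' := ZMod.val_lt hz'
  have h6 : (hz.val : ℤ) = hz'.val := eq_of_dvd_of_lt' h4 (by omega) (by omega)
  exact ⟨rfl, rfl, by exact_mod_cast ht0, ZMod.val_injective p (by exact_mod_cast h6)⟩

/-- The cell set has `#T · p^{m−1} · p` cells. [folklore] -/
theorem card_cellSetQ [NeZero p] (hm : 2 ≤ m) (hB : B.NondegQ p m) (T : Finset ((Fin 3 × Fin 3) × ZMod p)) :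
    #(B.cellSetQ p m T) = #T * (p ^ (m - 1) * p) := by
  rw [cellSetQ, card_biUnion]
  · have : ∀ a ∈ T, #((range (p ^ (m - 1)) ×ˢ range p).image fun q : ℕ × ℕ =>
        B.cellQ p m a.1 (q.1 : ℤ) (q.2 : ℤ) (a.2.val : ℤ)) = p ^ (m - 1) * p := by
      intro a _
      rw [card_image_of_injOn, card_product, card_range, card_range]
      rintro ⟨K₁, t₀⟩ hq ⟨K₁', t₀'⟩ hq' e
      simp only [coe_product, coe_range, Set.mem_prod, Set.mem_Iio] at hq hq'
      obtain ⟨-, h1, h2, -⟩ := B.cellQ_inj hm hB hq.1 hq'.1 hq.2 hq'.2 e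
      rw [h1, h2]
    rw [sum_congr rfl this, sum_const, smul_eq_mul]
  · intro a _ a' _ haa'
    rw [Function.onFun, disjoint_left]
    intro P hP hP'
    obtain ⟨q, hq, rfl⟩ := mem_image.1 hP
    obtain ⟨q', hq', e⟩ := mem_image.1 hP'
    simp only [mem_product, mem_range] at hq hq'
    obtain ⟨hc, -, -, hh⟩ := B.cellQ_inj hm hB hq'.1 hq.1 hq'.2 hq.2 e
    exact haa' (Prod.ext hc.symm hh.symm)

/-- An independent pattern gives an independent cell set. [folklore] -/
theorem cellSetQ_indep [NeZero p] [Fact (2 ≤ m)] {T : Finset ((Fin 3 × Fin 3) × ZMod p)} (hT : B.PatIndepM p T) :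
    ∀ P ∈ B.cellSetQ p m T, ∀ P' ∈ B.cellSetQ p m T, P ≠ P' → cellWord P P' ≠ 1 := by
  intro P hP P' hP' hne hw
  obtain ⟨a, ha, K₁, t₀, hK, ht, rfl⟩ := B.mem_cellSetQ.1 hP
  obtain ⟨b, hb, K₁', t₀', hK', ht', rfl⟩ := B.mem_cellSetQ.1 hP'
  obtain ⟨d1, d2⟩ := dvd_of_cellWord' hw
  have hKlt : ((K₁ : ℕ) : ℤ) < (p : ℤ) ^ (m - 1) := by exact_mod_cast hK
  have hKlt' : ((K₁' : ℕ) : ℤ) < (p : ℤ) ^ (m - 1) := by exact_mod_cast hK'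
  have e1 : (t₀ : ℤ) = t₀' := eq_of_dvd_of_lt' d1 (by omega) (by omega)
  have e2 : (K₁ : ℤ) = K₁' := eq_of_dvd_of_lt' d2 (by omega) (by omega)
  have e1' : t₀ = t₀' := by exact_mod_cast e1
  have e2' : K₁ = K₁' := by exact_mod_cast e2
  subst e1' e2'
  have d3 := dvd_height_of_cellWord' hw
  by_cases hab : a = b
  · subst hab; exact hne rfl
  · apply hT a ha b hb hab
    rw [sub_eq_iff_eq_add]
    have : (((a.2.val : ℤ) - b.2.val - B.tauI a.1 b.1 : ℤ) : ZMod p) = 0 :=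
      (ZMod.intCast_zmod_eq_zero_iff_dvd _ _).2 d3
    push_cast at this
    rw [ZMod.natCast_zmod_val, ZMod.natCast_zmod_val] at this
    linear_combination this

/-- **The pattern lemma for `M_p(m,1)`**: an independent height pattern with `9p ≤ 5·#T` makes `Mmeta p m` not box-useful —
the SAME patterns as for `M(p³)`. [folklore] -/
theorem not_boxUseful_mmeta_of_pattern [NeZero p] [Fact (2 ≤ m)] (hB : B.NondegQ p m)
    {T : Finset ((Fin 3 × Fin 3) × ZMod p)} (hT : B.PatIndepM p T) (hbig : 9 * p ≤ 5 * #T) : ¬ BoxUseful (Mmeta p m) := by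
  have hm : 2 ≤ m := Fact.out
  refine not_boxUseful_of_indep (Y := univ.image (B.yQ p m)) (W := univ.image (B.wQ p m)) (J := B.cellSetQ p m T)
    (by rw [card_image_of_injective _ hB.y_inj, card_univ, Fintype.card_fin])
    (by rw [card_image_of_injective _ hB.w_inj, card_univ, Fintype.card_fin])
    (B.cellSetQ_subset T) (B.cellSetQ_indep hT) ?_
  rw [B.card_cellSetQ hm hB, Mmeta.card, show p ^ m = p ^ (m - 1) * p by rw [← pow_succ]; congr 1; omega]
  calc 9 * (p * (p ^ (m - 1) * p)) = (9 * p) * (p ^ (m - 1) * p) := by ring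
    _ ≤ (5 * #T) * (p ^ (m - 1) * p) := Nat.mul_le_mul_right _ hbig
    _ = 5 * (#T * (p ^ (m - 1) * p)) := by ring

end Mcube.IBox

end Summit.MatrixMultiplication.OmegaCensus
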